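import Summits.BirchSwinnertonDyer.BirchSwinnertonDyer.Theorems.PrintCf2RamifiedOffTYZSecondNormLawsPrints
import Literature.NumberTheory.EllipticCurves.Monsky1990.MockHeegnerCongruentNumbers
import Literature.NumberTheory.EllipticCurves.Tian2014.CongruentNumbersHeegnerPoints
import Literature.NumberTheory.EllipticCurves.SelmerCountShaTorsionProofs
import HarnessLib

/-!
# The REMAINDER of C⁺ is VACUOUS on the printed rank-one families of the bundle: Monsky's Cor. 5.15 families and Tian's 2014 families
# carry `#Sel₂(E_n) = 8 ≠ 32` (crux stmt-BirchSwinnertonDyer-20509 `RamifiedOffTYZOfFacts`, line `offtyz-v7`, LEAD cruxlead-20509 g34, cycle 35)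

HONEST FRAMING (cell `bsd-print-cf2`, route `PrintCf2`; `--supports stmt-BirchSwinnertonDyer-20509`; theorems only, `def`-free, no `sorry`,
no named fact introduced).  BSD is not proved by any of this; no class is closed by this file; item 23431 (C⁺), its remainder stub
`stub_offTYZ_levelTwo_offVisR2` and crux 20509 stay OPEN.

WHAT.  The remainder stub of the exact-descent re-cut (skeleton v10–v13) reads: granted 𝔅_ram, for square-free `n ≡ 5, 6, 7 (mod 8)` with
`ord_{s=1} L(E_n, s) = 1`, `#Sel₂(E_n) = 2⁵`, `#Sel₄(E_n) = 2⁶` and NOT a visible R2 row, every `L` with `𝓛(n)² = L²` has `2 ∥ L`.  Two conjuncts of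
𝔅_ram PRINT the full `2`-descent on explicit families that lie inside this domain:
* conjunct 9, Monsky 1990 Cor. 5.15 (`Monsky1990.cor515_rank_eq_one_and_card_selmerGroup_two`): on `IsCor515Family n` — `p₅, p₇, 2p₃, 2p₇, p₃p₇,
  p₃p₅, 2p₃p₅, 2p₅p₇, p₁p₅ / p₁p₇ / 2p₁p₇ / 2p₁p₃ with (p₁/p) = −1` — `rank E_n(ℚ) = 1` and `#Sel₂(E_n) = 8`;
* conjunct 6, Tian 2014 Thm. 1.3 (`Tian2014.thm13_rank_one_and_sha_odd`): on `m = n, 2n` with `n = p₀p₁⋯p_k`, `p_i ≡ 1 (mod 8)` for `i ≥ 1`,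
  and Condition (1.1) for `ℚ(√−2n)`: `rank E_m(ℚ) = 1`, `Ш(E_m)` finite of ODD order — hence `Ш(E_m)[2] = 0` and, by the descent count
  `#Sel₂ = 2^{rank}·#E(ℚ)[2]·#Ш[2]` (Silverman X.4.2, tree `natCard_selmerGroup_eq_iff_sha_torsion_eq_zero`) with `#E_m(ℚ)[2] = 4`, `#Sel₂(E_m) = 8`.
So on both families the hypothesis `#Sel₂(E_n) = 2⁵` is CONTRADICTORY and the remainder's conclusion holds vacuously.  In particular the two-prime
rows `n = lq`, `l ≡ 1`, `q ≡ 7 (mod 8)`, `(l/q) = −1` (TYZ's PROVED side, Thm. 1.3 (lg′); g29/g31: rung `v = 0`) are not jump-one rows.  This is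
bookkeeping for the LEAD's reshape v14 (the remainder's open content is: invisible R2 rows, R1 rows, `n ≡ 6 (mod 8)`, three or more primes — OFF the
printed families), not progress on C⁺.

References: [cite: Monsky1990MockHeegner, Cor. 5.15 (p. 66), Remark (2) (p. 67)]; [cite: Tian2014, Thm. 1.3]; [cite: SilvermanAEC2009, Thm. X.4.2];
[cite: TianYuanZhang2017, Thm. 1.3]; tree: `Monsky1990/MockHeegnerCongruentNumbers.lean`, `Tian2014/CongruentNumbersHeegnerPoints.lean`,
`SelmerCountShaTorsionProofs.lean`, `Smith2016.natCard_torsionBy_two_congruentNumberCurve`.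
-/

noncomputable section

open scoped Classical

open WeierstrassCurve Literature.NumberTheory.EllipticCurves
  Literature.NumberTheory.EllipticCurves.TianYuanZhang2017
  Literature.NumberTheory.EllipticCurves.TianYuanZhang2017.W2

set_option autoImplicit false

namespace Summit.BirchSwinnertonDyer.PrintCf2.RemainderPrintedFamilies

/-! ## §1. Descent count: rank one and `Ш[2] = 0` give `#Sel₂ = 8`, never `32` -/

/-- In a finite additive group of ODD order there is no `2`-torsion: `2 • x = 0 ⟹ x = 0` (the order of `x` divides `2` and the odd
cardinality). [folklore] -/
theorem two_torsion_eq_zero_of_odd_card {G : Type*} [AddCommGroup G] [Finite G] (hodd : Odd (Nat.card G)) (x : G)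
    (hx : (2 : ℤ) • x = 0) : x = 0 := by
  have hx' : (2 : ℕ) • x = 0 := by
    rw [← natCast_zsmul]; exact_mod_cast hx
  have h2 : addOrderOf x ∣ 2 := addOrderOf_dvd_of_nsmul_eq_zero hx'
  have hc : addOrderOf x ∣ Nat.card G := addOrderOf_dvd_natCard x
  have hodd' : Odd (addOrderOf x) := hodd.of_dvd_nat hc
  have h1 : addOrderOf x = 1 := by
    rcases (Nat.dvd_prime Nat.prime_two).mp h2 with h | h
    · exact h
    · exact absurd (h ▸ hodd') (by decide)
  exact AddMonoid.addOrderOf_eq_one_iff.mp h1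

/-- **Descent count on a rank-one congruent-number curve with `Ш[2] = 0`.**  For `n ≠ 0`, if `rank E_n(ℚ) = 1` and `Ш(E_n/ℚ)` has no `2`-torsion,
then `#Sel₂(E_n) = 8` (`= 2¹ · #E_n(ℚ)[2]`, `#E_n(ℚ)[2] = 4`). [cite: SilvermanAEC2009, Thm. X.4.2] -/
theorem card_selmerGroup_two_eq_eight_of_rank_one {n : ℕ} (hn : n ≠ 0)
    (hr : haveI := isElliptic_congruentNumberCurve hn; (congruentNumberCurve n).mordellWeilRank = 1)
    (hsha : haveI := isElliptic_congruentNumberCurve hn; ∀ x : (congruentNumberCurve n).sha, (2 : ℤ) • x = 0 → x = 0) :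
    haveI := isElliptic_congruentNumberCurve hn
    Nat.card ((congruentNumberCurve n).selmerGroup 2) = 8 := by
  haveI := isElliptic_congruentNumberCurve hn
  have hcount := ((congruentNumberCurve n).natCard_selmerGroup_eq_iff_sha_torsion_eq_zero (n := 2) two_ne_zero).mpr
    (by simpa only [Nat.cast_ofNat] using hsha)
  have h' : Nat.card ((congruentNumberCurve n).selmerGroup ((2 : ℕ) : ℤ)) = 8 := by
    rw [hcount, hr, pow_one]
    -- `#E_n(ℚ)[2] = 4`; the generic count carries the classical `DecidableEq` inside `E(ℚ)`, bridged by `convert`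
    have aux : ∀ {T : ℕ}, T = 4 → 2 * T = 8 := by intro T hT; subst hT; norm_num
    exact aux (by convert Smith2016.natCard_torsionBy_two_congruentNumberCurve hn; norm_num)
  simpa only [Nat.cast_ofNat] using h'

/-- **Rank one and `Ш` finite of odd order ⟹ `#Sel₂(E_n) = 8`.** [cite: SilvermanAEC2009, Thm. X.4.2] -/
theorem card_selmerGroup_two_eq_eight_of_rank_one_of_sha_odd {n : ℕ} (hn : n ≠ 0)
    (hr : haveI := isElliptic_congruentNumberCurve hn; (congruentNumberCurve n).mordellWeilRank = 1)
    (hfin : haveI := isElliptic_congruentNumberCurve hn; Finite (congruentNumberCurve n).sha)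
    (hodd : haveI := isElliptic_congruentNumberCurve hn; Odd (Nat.card (congruentNumberCurve n).sha)) :
    haveI := isElliptic_congruentNumberCurve hn
    Nat.card ((congruentNumberCurve n).selmerGroup 2) = 8 := by
  haveI := isElliptic_congruentNumberCurve hn
  haveI := hfin
  exact card_selmerGroup_two_eq_eight_of_rank_one hn hr (two_torsion_eq_zero_of_odd_card hodd)

/-! ## §2. Monsky's Cor. 5.15 families (conjunct 9 of 𝔅_ram): `#Sel₂ = 8`, so no jump-one row -/

/-- **On every Cor. 5.15 family member `#Sel₂(E_n) ≠ 2⁵`** (it is `8`; conjunct 9 of 𝔅_ram BY NAME).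
[cite: Monsky1990MockHeegner, Cor. 5.15 (p. 66), Remark (2) (p. 67)] -/
theorem card_selmerGroup_two_ne_32_of_cor515 (h9 : Monsky1990.cor515_rank_eq_one_and_card_selmerGroup_two) {n : ℕ}
    (hF : Monsky1990.IsCor515Family n) :
    haveI := isElliptic_congruentNumberCurve hF.ne_zero
    Nat.card ((congruentNumberCurve n).selmerGroup 2) ≠ 2 ^ 5 := by
  haveI := isElliptic_congruentNumberCurve hF.ne_zero
  have h8 := (h9 n hF).2
  intro h32
  have : (8 : ℕ) = 2 ^ 5 := by
    have e1 : Nat.card ((congruentNumberCurve n).selmerGroup ((2 : ℕ) : ℤ)) = 8 := by simpa only [Nat.cast_ofNat] using h8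
    have e2 : Nat.card ((congruentNumberCurve n).selmerGroup ((2 : ℕ) : ℤ)) = 2 ^ 5 := by simpa only [Nat.cast_ofNat] using h32
    rw [← e1, e2]
  norm_num at this

/-- The two-prime rows `n = lq`, `l ≡ 1 (mod 8)`, `q ≡ 5` or `7 (mod 8)`, `(l/q) = −1` are Cor. 5.15 members (group (3)).  With `q` an odd prime
not dividing `l`, `(l/q) = −1` is «`l` is not a square mod `q`» (`ZMod.legendreSym` / `jacobiSym` at a prime).
[cite: Monsky1990MockHeegner, Cor. 5.15 (3) (p. 66)] -/
theorem isCor515Family_of_two_primes_nonresidue {l q : ℕ} (hl : l.Prime) (hq : q.Prime) (hl8 : l % 8 = 1)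
    (hq8 : q % 8 = 5 ∨ q % 8 = 7) (hnr : ¬ IsSquare ((l : ℤ) : ZMod q)) : Monsky1990.IsCor515Family (l * q) := by
  haveI : Fact q.Prime := ⟨hq⟩
  have hj : jacobiSym (l : ℤ) q = -1 := by
    rw [← jacobiSym.legendreSym.to_jacobiSym, legendreSym.eq_neg_one_iff]
    exact hnr
  refine Or.inr (Or.inr (Or.inr (Or.inr (Or.inl ⟨l, q, hl, hq, hl8, hq8, ?_, rfl⟩))))
  exact_mod_cast hj

/-- **The remainder of C⁺ holds VACUOUSLY on Monsky's Cor. 5.15 families**, granted 𝔅_ram (conjunct 9): there `#Sel₂(E_n) = 8`, contradicting the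
jump-one hypothesis `#Sel₂(E_n) = 2⁵`.  Stated in the binder shape of the remainder stub `stub_offTYZ_levelTwo_offVisR2` (skeleton v10–v13), with
the family predicate in place of «not a visible R2 row».  No content about C⁺.
[cite: Monsky1990MockHeegner, Cor. 5.15 (p. 66)] [cite: TianYuanZhang2017, Thm. 1.3] -/
theorem offTYZ_levelTwo_of_isCor515Family (hB : (Literature.NumberTheory.EllipticCurves.rank_eq_analyticRank_of_analyticRank_le_one ∧ WeierstrassCurve.hasEntireLFunction_rat ∧ WeierstrassCurve.bsdRHS_eq_of_isIsogenous ∧ Literature.NumberTheory.EllipticCurves.bsdTriple_of_hasCM_of_L_one_ne_zero ∧ Literature.NumberTheory.EllipticCurves.TianYuanZhang2017.thm12_parity_of_scriptL' ∧ Literature.NumberTheory.EllipticCurves.Tian2014.thm13_rank_one_and_sha_odd ∧ Literature.NumberTheory.QuadraticFields.RedeiReichardt.redeiReichardt_fourTwoCard_classGroup ∧ Literature.NumberTheory.EllipticCurves.LiLiuTian2024.thm12_bsd_congruentNumberCurve ∧ Literature.NumberTheory.EllipticCurves.Monsky1990.cor515_rank_eq_one_and_card_selmerGroup_two ∧ Literature.NumberTheory.EllipticCurves.HeathBrown1994.monsky_card_selmerGroup_two_even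 ∧ Literature.NumberTheory.EllipticCurves.Tian2014.tian2014_system_sMinus_genus)) :
    ∀ (n : ℕ) [(congruentNumberCurve n).IsElliptic] [(congruentNumberCurve n).IsGloballyMinimal],
      Monsky1990.IsCor515Family n →
      Nat.card ((congruentNumberCurve n).selmerGroup 2) = 2 ^ 5 →
      ∀ L : ℤ, IsScriptL n L → (2 : ℤ) ∣ L ∧ ¬ (4 : ℤ) ∣ L := by
  intro n _ _ hF hSel2 L _
  exact absurd (by convert hSel2) (card_selmerGroup_two_ne_32_of_cor515 hB.2.2.2.2.2.2.2.2.1 hF)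

/-- The two-prime rows `n = lq` with `(l/q) = −1` of the remainder are vacuous, granted 𝔅_ram (conjunct 9).
[cite: Monsky1990MockHeegner, Cor. 5.15 (3) (p. 66)] [cite: TianYuanZhang2017, Thm. 1.3] -/
theorem offTYZ_levelTwo_of_two_primes_nonresidue (hB : (Literature.NumberTheory.EllipticCurves.rank_eq_analyticRank_of_analyticRank_le_one ∧ WeierstrassCurve.hasEntireLFunction_rat ∧ WeierstrassCurve.bsdRHS_eq_of_isIsogenous ∧ Literature.NumberTheory.EllipticCurves.bsdTriple_of_hasCM_of_L_one_ne_zero ∧ Literature.NumberTheory.EllipticCurves.TianYuanZhang2017.thm12_parity_of_scriptL' ∧ Literature.NumberTheory.EllipticCurves.Tian2014.thm13_rank_one_and_sha_odd ∧ Literature.NumberTheory.QuadraticFields.RedeiReichardt.redeiReichardt_fourTwoCard_classGroup ∧ Literature.NumberTheory.EllipticCurves.LiLiuTian2024.thm12_bsd_congruentNumberCurve ∧ Literature.NumberTheory.EllipticCurves.Monsky1990.cor515_rank_eq_one_and_card_selmerGroup_two ∧ Literature.NumberTheory.EllipticCurves.HeathBrown1994.monsky_card_selmerGroup_two_even ∧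 Literature.NumberTheory.EllipticCurves.Tian2014.tian2014_system_sMinus_genus)) :
    ∀ (l q n : ℕ) [(congruentNumberCurve n).IsElliptic] [(congruentNumberCurve n).IsGloballyMinimal],
      l.Prime → q.Prime → l % 8 = 1 → (q % 8 = 5 ∨ q % 8 = 7) → ¬ IsSquare ((l : ℤ) : ZMod q) → n = l * q →
      Nat.card ((congruentNumberCurve n).selmerGroup 2) = 2 ^ 5 →
      ∀ L : ℤ, IsScriptL n L → (2 : ℤ) ∣ L ∧ ¬ (4 : ℤ) ∣ L := by
  intro l q n _ _ hl hq hl8 hq8 hnr hn hSel2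
  subst hn
  exact offTYZ_levelTwo_of_isCor515Family hB (l * q) (isCor515Family_of_two_primes_nonresidue hl hq hl8 hq8 hnr) hSel2

/-! ## §3. Tian's 2014 families (conjunct 6 of 𝔅_ram): rank one, `Ш` odd, so `#Sel₂ = 8` and no jump-one row -/

/-- **On every member of Tian's Thm. 1.3 families `#Sel₂(E_m) = 8`**, granted conjunct 6 of 𝔅_ram BY NAME (rank one, `Ш` finite of odd order)
and the descent count. [cite: Tian2014, Thm. 1.3] [cite: SilvermanAEC2009, Thm. X.4.2] -/
theorem card_selmerGroup_two_eq_eight_of_tian2014 (h6 : Tian2014.thm13_rank_one_and_sha_odd)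
    (k : ℕ) (p : Fin (k + 1) → ℕ) (hp : ∀ i, (p i).Prime) (hp2 : ∀ i, p i ≠ 2) (hinj : Function.Injective p)
    (h1 : ∀ i, i ≠ 0 → p i % 8 = 1) (n : ℕ) (hn : n = ∏ i, p i)
    (K : Type) [Field K] [NumberField K] (hK : Tian2014.IsQuadraticFieldOfSqrt K (-(2 * n : ℤ))) (hC : Tian2014.Condition11 n K)
    (m : ℕ) (hm : m = n ∨ m = 2 * n) (hm8 : m % 8 = 5 ∨ m % 8 = 6 ∨ m % 8 = 7) (hm0 : m ≠ 0) :
    haveI := isElliptic_congruentNumberCurve hm0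
    Nat.card ((congruentNumberCurve m).selmerGroup 2) = 8 := by
  obtain ⟨hr, -, hfin, hodd⟩ := h6 k p hp hp2 hinj h1 n hn K hK hC m hm hm8
  exact card_selmerGroup_two_eq_eight_of_rank_one_of_sha_odd hm0 (by convert hr) (by convert hfin) (by convert hodd)

/-- **The remainder of C⁺ holds VACUOUSLY on Tian's Thm. 1.3 families**, granted 𝔅_ram (conjunct 6): there `#Sel₂(E_m) = 8 ≠ 2⁵`.  Binder shape of
the remainder stub, with the family data in place of «not a visible R2 row».  No content about C⁺.
[cite: Tian2014, Thm. 1.3] [cite: SilvermanAEC2009, Thm. X.4.2] [cite: TianYuanZhang2017, Thm. 1.3] -/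
theorem offTYZ_levelTwo_of_tian2014Family (hB : (Literature.NumberTheory.EllipticCurves.rank_eq_analyticRank_of_analyticRank_le_one ∧ WeierstrassCurve.hasEntireLFunction_rat ∧ WeierstrassCurve.bsdRHS_eq_of_isIsogenous ∧ Literature.NumberTheory.EllipticCurves.bsdTriple_of_hasCM_of_L_one_ne_zero ∧ Literature.NumberTheory.EllipticCurves.TianYuanZhang2017.thm12_parity_of_scriptL' ∧ Literature.NumberTheory.EllipticCurves.Tian2014.thm13_rank_one_and_sha_odd ∧ Literature.NumberTheory.QuadraticFields.RedeiReichardt.redeiReichardt_fourTwoCard_classGroup ∧ Literature.NumberTheory.EllipticCurves.LiLiuTian2024.thm12_bsd_congruentNumberCurve ∧ Literature.NumberTheory.EllipticCurves.Monsky1990.cor515_rank_eq_one_and_card_selmerGroup_two ∧ Literature.NumberTheory.EllipticCurves.HeathBrown1994.monsky_card_selmerGroup_two_even ∧ Literature.NumberTheory.EllipticCurves.Tian2014.tian2014_system_sMinus_genus))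
    (k : ℕ) (p : Fin (k + 1) → ℕ) (hp : ∀ i, (p i).Prime) (hp2 : ∀ i, p i ≠ 2) (hinj : Function.Injective p)
    (h1 : ∀ i, i ≠ 0 → p i % 8 = 1) (n : ℕ) (hn : n = ∏ i, p i)
    (K : Type) [Field K] [NumberField K] (hK : Tian2014.IsQuadraticFieldOfSqrt K (-(2 * n : ℤ))) (hC : Tian2014.Condition11 n K) :
    ∀ (m : ℕ) [(congruentNumberCurve m).IsElliptic] [(congruentNumberCurve m).IsGloballyMinimal],
      (m = n ∨ m = 2 * n) → (m % 8 = 5 ∨ m % 8 = 6 ∨ m % 8 = 7) →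
      Nat.card ((congruentNumberCurve m).selmerGroup 2) = 2 ^ 5 →
      ∀ L : ℤ, IsScriptL m L → (2 : ℤ) ∣ L ∧ ¬ (4 : ℤ) ∣ L := by
  intro m _ _ hm hm8 hSel2 L _
  have hm0 : m ≠ 0 := by rintro rfl; omega
  have h8 := card_selmerGroup_two_eq_eight_of_tian2014 hB.2.2.2.2.2.1 k p hp hp2 hinj h1 n hn K hK hC m hm hm8 hm0
  exfalso
  have : (8 : ℕ) = 2 ^ 5 := by rw [← h8]; convert hSel2
  norm_num at this

end Summit.BirchSwinnertonDyer.PrintCf2.RemainderPrintedFamilies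

end
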